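import Summits.QuantumFields.BalabanUV.Beta.D1BFx.RestKernelSandwichUnit
import Summits.QuantumFields.BalabanUV.Beta.D1BFx.RestJetBlockMass
import Summits.QuantumFields.BalabanUV.Beta.D1BFx.RestTableBlockMass

/-!
# `BalabanUV.Beta.D1BFx.RestKernelSandwichPacked` — road «BF-x» for binder row D1, slot (K), DICT-CHAIN-SPEC §2 (II) row RK-SAND: **«RK-SAND
# PACKED-IN-STENCILS» — THE 1 + 3 SANDWICH CROSS WORDS AT THE ROAD's PACKED N-JETS `ffV (vertexOfK (NlegRoad m a) n S)`, `ffW (vertex2OfK (NlegRoad m a) n S₂)`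
# ARE (5.10)-KERNELS WITH THE n-POWERS DISPLAYED AND THE PACK LETTERS `mS`, `mT` GENERIC** (the letter moved ONE LEVEL DOWN, from the jets to the STENCILS,
# exactly as leaf-04 g19's «RK-JET BLOCK MASSES» ∕ «RK-TABLE BLOCK MASSES» do for the block words; the (A2-N) dictionary names the packs `S_N`, `S₂,N` —
# NOT guessed here, OWNER W-7 (2) ∕ W-d1p2-g18-3)

HONEST DEPENDENCY (cell records, verbatim): «continuum YM on T⁴ ⇐ BetaPertH ∧ nine spine estimates (0/9 proved); BetaPertH ⇐ (D1) ∧ (D4) ∧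
CAP+tail; G-an2-4 gates asym, D1 and NE2/3/4.»  HONEST FRAMING (cell contract, verbatim): «discharging `BetaPertH` makes Bałaban's UV stability
UNCONDITIONAL — a real constructive-QFT result; it is NOT the continuum limit and NOT the Clay problem.»  THIS MODULE DISCHARGES NOTHING of the
wall: [folklore] composition BY NAME of leaf-01's «RK-SAND GENERIC-IN-JETS» `RestKernelSandwichUnit.exists_decay510_crossWord_road` (p318931) with
leaf-04 g19's packed jet∕table block masses `RestJetBlockMass.mass_blk_vertexOfK_NlegRoad_le` ∕ `RestTableBlockMass.mass_blk_vertex2OfK_NlegRoad_le`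
at the ff blocks; modulo the displayed [B5] hypotheses `h12` ∕ `h126` those files already carry; 0 `sorry`, 0 definitions, 0 notation, nothing cited.
0 root-level binders of row D1 discharged (hW ∕ hR-sockets ∕ hSX-socket ∕ D1Tel ∕ D1Rep — 0); (K) NOT closed (the packs `S_N`, `S₂,N` of (A2-N) are
not named; the `Rk`-member wiring follows the naming); NOT D1, NOT `BetaPertH`, NOT continuum, NOT Clay.

ABSOLUTE RULE (cell charter, verbatim): «No internally-minted statement may enter as a cited fact. Every hypothesis is either kernel-proved in
this package or a verbatim quotation of a PUBLISHED theorem with page reference. The manuscript(s) under audit are NOT citable for their own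
disputed steps — they are the thing under adjudication; programme-internal (2001/route/tribunal) claims are never citable.»

CONTENT (`n = m + 1`; `C_V := 4·C₄·e^{κ′}·(1 + 16∕κ′)⁴`, `C_T := 16·(C₄·e^{κ′})²·(1 + 16∕κ′)⁴·Zl 4 (δ∕2)`, `C₄ := MG163 4·periodConst (kappa163 4) 3`, `κ′ := kappa163 4∕4`):
* [mod `h12 ∧ h126`] **`exists_decay510_crossWord_road_packed`**: ONE n-free triple `kG, K ≥ 0`, `c > 0` such that for every `m`, every first-jet PACK `S` whose
  ff∕fm∕mf∕mm blocks have centred weighted masses `≤ mS j k` at a rate `0 ≤ σ ≤ c∕n`, every pair PACK `S₂` whose blocks have masses `≤ mT j i·e^{−δ|u′−u|₁}`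
  (`δ > 0`), the tadpole word is `Decay510 … (½·(K∕(2n²))·(C_T·(n⁶)⁻¹·mT tt)) (min (κ′∕8) (δ∕2))` — NET `n⁻⁸` × pack letters — and the three bubble words
  (+ the empty one) are `Decay510 … (½·(L_x·L_y·(C_V·n⁻¹·mS tt)·(C_V·n⁻¹·mS tt))) (σ·n)`, `L_true = K∕(2n²)`, `L_false = kG∕2` — NET `n⁻²`, `n⁻⁴`, `n⁻⁶` × pack letters
  (take `σ := min c (δ_S∕2)∕n` for a pack self-localised at the n-free rate `δ_S`: bubble rate `min c (δ_S∕2)`, n-free).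
* [mod `h12 ∧ h126`] **`exists_rows_crossWord_road_packed`**: the (1.22) read-out of the same — `AbsMoment₂` (the `hMR` row shape) and
  `|secondMoment| ≤ (constant above)·Σ'_x |x|₁²e^{−rate·|x|₁}` (the `hU` row shape) for all four words (`0 < σ`), rates `min (κ′∕8) (δ∕2)` and `σ·n`.
NOT HERE (honest): the packs of the (A2-N) dictionary; the `Rk`-member wiring (pattern `RestKernelGhostWiring`) — after the naming.
Unit `b2b-balaban-beta-d1-formalise-leaf-01` (gen 22), D1 formalisation swarm leaf prover 01, road «BF-x»; INTENT «RK-SAND PACKED-IN-STENCILS» (journal).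
-/

noncomputable section

open Finset
open scoped BigOperators
open Literature.MathematicalPhysics.QuantumFieldTheory.Balaban1983to89
open Literature.MathematicalPhysics.QuantumFieldTheory.Balaban1983to89.Beta
open B12Sec2to5 (l1 Decay510 secondMoment_abs_le_of_decay510)
open DecimatedMomentSummable (AbsMoment₂ absMoment₂_of_decay510)
open B5Hk163Strip (kappa163 kappa163_pos)
open B5Hk163Decay (MG163)
open B4TorusKernel (periodConst)
open ExpKernelCalculus (Site MKer Zl)
open SecondOrderResponse (vertex2OfK)
open OneStepResolventKernel (Fib)
open OneStepKernelFamily (vertexOfK)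
open VectorTailsLoc (fam kfam)
open Summit.QuantumFields.BalabanUV.Beta.D1BFx.PackedKernelSplit (blk ffV ffW ffW_apply)
open Summit.QuantumFields.BalabanUV.Beta.D1BFx.CoarseGramInverse (multM)
open Summit.QuantumFields.BalabanUV.Beta.D1BFx.RWeightedLegPack (sandP NlegRoad)
open Summit.QuantumFields.BalabanUV.Beta.D1BFx.GluonLeg (Ga)
open Summit.QuantumFields.BalabanUV.Beta.D1BFx.FrozenLegTails (nOf MOf hn1)
open Summit.QuantumFields.BalabanUV.Beta.D1BFx.RestKernelWords (crossWord)
open Summit.QuantumFields.BalabanUV.Beta.D1BFx.RestKernelSandwichUnit (exists_decay510_crossWord_road)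
open Summit.QuantumFields.BalabanUV.Beta.D1BFx.RestJetBlockMass (mass_blk_vertexOfK_NlegRoad_le)
open Summit.QuantumFields.BalabanUV.Beta.D1BFx.RestTableBlockMass (mass_blk_vertex2OfK_NlegRoad_le)

namespace Summit.QuantumFields.BalabanUV.Beta.D1BFx.RestKernelSandwichPacked

variable {a : ℝ} (ha : 0 < a)
include ha

/-- [folklore] **«RK-SAND PACKED-IN-STENCILS»** (mod [B5, Prop. 1.2] ∧ [B5, (1.126)–(1.127)] BY NAME): ONE n-free triple `kG, K ≥ 0`, `c > 0`, chosen
before `n`, such that for every `m` (`n = m + 1`), every rate `0 ≤ σ ≤ c∕n`, every first-jet pack `S` with block letters `mS` at the rate `σ`, every pair pack `S₂` with block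
letters `mT·e^{−δ|u′−u|₁}` (`0 < δ`), the road's four sandwich cross words at the PACKED N-jets `ffV (vertexOfK (NlegRoad m a) n S)`,
`ffW (vertex2OfK (NlegRoad m a) n S₂)` satisfy: tadpole `Decay510 … (½·(K∕2∕n²·(C_T·(n⁶)⁻¹·mT tt))) (min (κ′∕8) (δ∕2))`; bubbles
`Decay510 … (½·(L_x·L_y·(C_V·n⁻¹·mS tt)·(C_V·n⁻¹·mS tt))) (σ·n)`, `L_true = K∕2∕n²`, `L_false = kG∕2` — leaf-01's `exists_decay510_crossWord_road` at
`mV := C_V·n⁻¹·mS tt`, `mW := C_T·(n⁶)⁻¹·mT tt` (leaf-04's `mass_blk_vertexOfK_NlegRoad_le` ∕ `mass_blk_vertex2OfK_NlegRoad_le` at the ff blocks),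
`c := min c_RS (kappa163 4∕64)` (so that `σ ≤ c∕n ≤ κ′∕(16n)`), `κ := min (κ′∕8) (δ∕2)`. -/
theorem exists_decay510_crossWord_road_packed (h12 : B5.Prop12Printed (fam nOf hn1 MOf a ha)) (h126 : B5.Kernel126_127Printed (kfam nOf MOf)) :
    ∃ kG K c : ℝ, 0 < c ∧ 0 ≤ kG ∧ 0 ≤ K ∧ ∀ (m : ℕ) (S : Fin 4 → Site 4 → MKer 4 (Fib 3))
      (S₂ : Fin 4 → Site 4 → Fin 4 → Site 4 → MKer 4 (Fib 3)) (σ δ : ℝ) (mS mT : Bool → Bool → ℝ) (μ ν : Fin 4),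
      0 ≤ σ → σ ≤ c / ((m + 1 : ℕ) : ℝ) → 0 < δ →
      (∀ κ' u j k, Summable fun p : Site 4 × Site 4 =>
        ∑ g, ∑ f, |blk (S κ' u) j k p.1 p.2 g f| * Real.exp (σ * (l1 (p.1 - u) + l1 (p.2 - u)))) →
      (∀ κ' u j k, ∑' p : Site 4 × Site 4,
        ∑ g, ∑ f, |blk (S κ' u) j k p.1 p.2 g f| * Real.exp (σ * (l1 (p.1 - u) + l1 (p.2 - u))) ≤ mS j k) →
      (∀ κ u κ' u' j i, Summable fun p : Site 4 × Site 4 => ∑ g, ∑ f, |blk (S₂ κ u κ' u') j i p.1 p.2 g f|) →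
      (∀ κ u κ' u' j i, ∑' p : Site 4 × Site 4, ∑ g, ∑ f, |blk (S₂ κ u κ' u') j i p.1 p.2 g f| ≤ mT j i * Real.exp (-δ * l1 (u' - u))) →
      (∀ u : Unit, Decay510 (crossWord ((2 : ℝ)⁻¹ • Ga (m + 1) a)
          ((-(2 : ℝ)⁻¹) • blk (sandP (m + 1) (Ga (m + 1) a) (multM (m + 1) (2 * a / ((m + 1 : ℕ) : ℝ) ^ 8) 2)) true true)
          (ffV (vertexOfK (NlegRoad m a) (m + 1) S)) (ffW (vertex2OfK (NlegRoad m a) (m + 1) S₂)) (Sum.inl u) μ ν)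
          ((1 / 2) * (K / 2 / (((m + 1 : ℕ) : ℝ)) ^ 2
            * (16 * ((MG163 4 * periodConst (kappa163 4) 3) * Real.exp (kappa163 4 / 4)) ^ 2 * (1 + 16 / (kappa163 4 / 4)) ^ 4 * Zl 4 (δ / 2)
                * ((((m + 1 : ℕ) : ℝ)) ^ 6)⁻¹ * mT true true)))
          (min (kappa163 4 / 4 / 8) (δ / 2))) ∧
      (∀ x y : Bool, Decay510 (crossWord ((2 : ℝ)⁻¹ • Ga (m + 1) a)
          ((-(2 : ℝ)⁻¹) • blk (sandP (m + 1) (Ga (m + 1) a) (multM (m + 1) (2 * a / ((m + 1 : ℕ) : ℝ) ^ 8) 2)) true true)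
          (ffV (vertexOfK (NlegRoad m a) (m + 1) S)) (ffW (vertex2OfK (NlegRoad m a) (m + 1) S₂)) (Sum.inr (x, y)) μ ν)
          ((1 / 2) * ((bif x then K / 2 / (((m + 1 : ℕ) : ℝ)) ^ 2 else kG / 2) * (bif y then K / 2 / (((m + 1 : ℕ) : ℝ)) ^ 2 else kG / 2)
            * (4 * (MG163 4 * periodConst (kappa163 4) 3) * Real.exp (kappa163 4 / 4) * (1 + 16 / (kappa163 4 / 4)) ^ 4
                * (((m + 1 : ℕ) : ℝ))⁻¹ * mS true true)
            * (4 * (MG163 4 * periodConst (kappa163 4) 3) * Real.exp (kappa163 4 / 4) * (1 + 16 / (kappa163 4 / 4)) ^ 4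
                * (((m + 1 : ℕ) : ℝ))⁻¹ * mS true true)))
          (σ * ((m + 1 : ℕ) : ℝ))) := by
  obtain ⟨kG, K, c₁, hc₁, hkG, hK, hroad⟩ := exists_decay510_crossWord_road ha h12 h126
  have hκ : 0 < kappa163 4 := kappa163_pos 4
  refine ⟨kG, K, min c₁ (kappa163 4 / 64), lt_min hc₁ (by positivity), hkG, hK,
    fun m S S₂ σ δ mS mT μ ν hσ0 hσc hδ hSs hSm hTs hTm => ?_⟩
  have hn0 : (0 : ℝ) < ((m + 1 : ℕ) : ℝ) := by exact_mod_cast Nat.succ_pos m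
  set c : ℝ := min c₁ (kappa163 4 / 64) with hcdef
  -- the jets' rate `σ ≤ c∕n` is below BOTH RK-SAND's `c₁∕n` and the packing threshold `κ′∕(16n)`
  have hσ1 : σ ≤ c₁ / ((m + 1 : ℕ) : ℝ) := hσc.trans (div_le_div_of_nonneg_right (min_le_left _ _) hn0.le)
  have hσκ : σ ≤ kappa163 4 / 4 / (16 * ((m + 1 : ℕ) : ℝ)) := by
    calc σ ≤ c / ((m + 1 : ℕ) : ℝ) := hσc
      _ ≤ (kappa163 4 / 64) / ((m + 1 : ℕ) : ℝ) := div_le_div_of_nonneg_right (min_le_right _ _) hn0.le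
      _ = kappa163 4 / 4 / (16 * ((m + 1 : ℕ) : ℝ)) := by ring
  -- the ff block of the packed first jet: leaf-04's jet block mass at `(true, true)`
  have hV := fun ρ y => mass_blk_vertexOfK_NlegRoad_le m ha h12 h126 hσ0 hσκ hSs hSm ρ y true true
  -- the ff block of the packed table at the tadpole's pair of sites `(μ, 0)`, `(ν, z)`: leaf-04's table block mass at `(true, true)`
  have hW := fun z => mass_blk_vertex2OfK_NlegRoad_le m ha h12 h126 hδ hTs hTm μ 0 ν z true true
  obtain ⟨hinl, hinr⟩ := hroad m (ffV (vertexOfK (NlegRoad m a) (m + 1) S)) (ffW (vertex2OfK (NlegRoad m a) (m + 1) S₂)) σ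
    (4 * (MG163 4 * periodConst (kappa163 4) 3) * Real.exp (kappa163 4 / 4) * (1 + 16 / (kappa163 4 / 4)) ^ 4
      * (((m + 1 : ℕ) : ℝ))⁻¹ * mS true true)
    (16 * ((MG163 4 * periodConst (kappa163 4) 3) * Real.exp (kappa163 4 / 4)) ^ 2 * (1 + 16 / (kappa163 4 / 4)) ^ 4 * Zl 4 (δ / 2)
      * ((((m + 1 : ℕ) : ℝ)) ^ 6)⁻¹ * mT true true)
    (min (kappa163 4 / 4 / 8) (δ / 2)) μ ν hσ0 hσ1
    (fun ρ y => (hV ρ y).1) (fun ρ y => (hV ρ y).2) (fun z => (hW z).1)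
    (fun z => by simpa only [sub_zero, ffW_apply] using (hW z).2)
  exact ⟨hinl, hinr⟩

/-- [folklore] **THE (1.22) ROWS OF THE PACKED SANDWICH WORDS** (mod [B5, Prop. 1.2] ∧ [B5, (1.126)–(1.127)] BY NAME): with the triple of
`exists_decay510_crossWord_road_packed`, every one of the four cross words at the packed N-jets has an absolutely summable second moment (`AbsMoment₂`,
the joint root's `hMR` row shape) and `|secondMoment| ≤ (its (5.10) constant)·Σ'_x |x|₁²·e^{−rate·|x|₁}` (the `hU` row shape) — tadpole at the n-free rate
`min (κ′∕8) (δ∕2)`, bubbles at the rate `σ·n` (`0 < σ`); by `absMoment₂_of_decay510` ∕ `secondMoment_abs_le_of_decay510`. -/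
theorem exists_rows_crossWord_road_packed (h12 : B5.Prop12Printed (fam nOf hn1 MOf a ha)) (h126 : B5.Kernel126_127Printed (kfam nOf MOf)) :
    ∃ kG K c : ℝ, 0 < c ∧ 0 ≤ kG ∧ 0 ≤ K ∧ ∀ (m : ℕ) (S : Fin 4 → Site 4 → MKer 4 (Fib 3))
      (S₂ : Fin 4 → Site 4 → Fin 4 → Site 4 → MKer 4 (Fib 3)) (σ δ : ℝ) (mS mT : Bool → Bool → ℝ) (μ ν : Fin 4),
      0 < σ → σ ≤ c / ((m + 1 : ℕ) : ℝ) → 0 < δ →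
      (∀ κ' u j k, Summable fun p : Site 4 × Site 4 =>
        ∑ g, ∑ f, |blk (S κ' u) j k p.1 p.2 g f| * Real.exp (σ * (l1 (p.1 - u) + l1 (p.2 - u)))) →
      (∀ κ' u j k, ∑' p : Site 4 × Site 4,
        ∑ g, ∑ f, |blk (S κ' u) j k p.1 p.2 g f| * Real.exp (σ * (l1 (p.1 - u) + l1 (p.2 - u))) ≤ mS j k) →
      (∀ κ u κ' u' j i, Summable fun p : Site 4 × Site 4 => ∑ g, ∑ f, |blk (S₂ κ u κ' u') j i p.1 p.2 g f|) →
      (∀ κ u κ' u' j i, ∑' p : Site 4 × Site 4, ∑ g, ∑ f, |blk (S₂ κ u κ' u') j i p.1 p.2 g f| ≤ mT j i * Real.exp (-δ * l1 (u' - u))) →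
      (∀ u : Unit,
        AbsMoment₂ (crossWord ((2 : ℝ)⁻¹ • Ga (m + 1) a)
          ((-(2 : ℝ)⁻¹) • blk (sandP (m + 1) (Ga (m + 1) a) (multM (m + 1) (2 * a / ((m + 1 : ℕ) : ℝ) ^ 8) 2)) true true)
          (ffV (vertexOfK (NlegRoad m a) (m + 1) S)) (ffW (vertex2OfK (NlegRoad m a) (m + 1) S₂)) (Sum.inl u) μ ν) ∧
        |B12Beta.secondMoment (crossWord ((2 : ℝ)⁻¹ • Ga (m + 1) a)
          ((-(2 : ℝ)⁻¹) • blk (sandP (m + 1) (Ga (m + 1) a) (multM (m + 1) (2 * a / ((m + 1 : ℕ) : ℝ) ^ 8) 2)) true true)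
          (ffV (vertexOfK (NlegRoad m a) (m + 1) S)) (ffW (vertex2OfK (NlegRoad m a) (m + 1) S₂)) (Sum.inl u)) μ ν|
          ≤ (1 / 2) * (K / 2 / (((m + 1 : ℕ) : ℝ)) ^ 2
              * (16 * ((MG163 4 * periodConst (kappa163 4) 3) * Real.exp (kappa163 4 / 4)) ^ 2 * (1 + 16 / (kappa163 4 / 4)) ^ 4 * Zl 4 (δ / 2)
                  * ((((m + 1 : ℕ) : ℝ)) ^ 6)⁻¹ * mT true true))
            * ∑' x : Site 4, l1 x ^ 2 * Real.exp (-(min (kappa163 4 / 4 / 8) (δ / 2)) * l1 x)) ∧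
      (∀ x y : Bool,
        AbsMoment₂ (crossWord ((2 : ℝ)⁻¹ • Ga (m + 1) a)
          ((-(2 : ℝ)⁻¹) • blk (sandP (m + 1) (Ga (m + 1) a) (multM (m + 1) (2 * a / ((m + 1 : ℕ) : ℝ) ^ 8) 2)) true true)
          (ffV (vertexOfK (NlegRoad m a) (m + 1) S)) (ffW (vertex2OfK (NlegRoad m a) (m + 1) S₂)) (Sum.inr (x, y)) μ ν) ∧
        |B12Beta.secondMoment (crossWord ((2 : ℝ)⁻¹ • Ga (m + 1) a)
          ((-(2 : ℝ)⁻¹) • blk (sandP (m + 1) (Ga (m + 1) a) (multM (m + 1) (2 * a / ((m + 1 : ℕ) : ℝ) ^ 8) 2)) true true)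
          (ffV (vertexOfK (NlegRoad m a) (m + 1) S)) (ffW (vertex2OfK (NlegRoad m a) (m + 1) S₂)) (Sum.inr (x, y))) μ ν|
          ≤ (1 / 2) * ((bif x then K / 2 / (((m + 1 : ℕ) : ℝ)) ^ 2 else kG / 2) * (bif y then K / 2 / (((m + 1 : ℕ) : ℝ)) ^ 2 else kG / 2)
              * (4 * (MG163 4 * periodConst (kappa163 4) 3) * Real.exp (kappa163 4 / 4) * (1 + 16 / (kappa163 4 / 4)) ^ 4
                  * (((m + 1 : ℕ) : ℝ))⁻¹ * mS true true)
              * (4 * (MG163 4 * periodConst (kappa163 4) 3) * Real.exp (kappa163 4 / 4) * (1 + 16 / (kappa163 4 / 4)) ^ 4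
                  * (((m + 1 : ℕ) : ℝ))⁻¹ * mS true true))
            * ∑' x : Site 4, l1 x ^ 2 * Real.exp (-(σ * ((m + 1 : ℕ) : ℝ)) * l1 x)) := by
  obtain ⟨kG, K, c, hc, hkG, hK, hpk⟩ := exists_decay510_crossWord_road_packed ha h12 h126
  refine ⟨kG, K, c, hc, hkG, hK, fun m S S₂ σ δ mS mT μ ν hσ hσc hδ hSs hSm hTs hTm => ?_⟩
  obtain ⟨hinl, hinr⟩ := hpk m S S₂ σ δ mS mT μ ν hσ.le hσc hδ hSs hSm hTs hTm
  have hκ0 : 0 < kappa163 4 := kappa163_pos 4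
  have hκ : 0 < min (kappa163 4 / 4 / 8) (δ / 2) := lt_min (by positivity) (half_pos hδ)
  have hn0 : (0 : ℝ) < ((m + 1 : ℕ) : ℝ) := by exact_mod_cast Nat.succ_pos m
  have hσn : 0 < σ * ((m + 1 : ℕ) : ℝ) := mul_pos hσ hn0
  refine ⟨fun u => ⟨absMoment₂_of_decay510 hκ (hinl u), ?_⟩, fun x y => ⟨absMoment₂_of_decay510 hσn (hinr x y), ?_⟩⟩
  · exact (secondMoment_abs_le_of_decay510 (P := crossWord ((2 : ℝ)⁻¹ • Ga (m + 1) a)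
      ((-(2 : ℝ)⁻¹) • blk (sandP (m + 1) (Ga (m + 1) a) (multM (m + 1) (2 * a / ((m + 1 : ℕ) : ℝ) ^ 8) 2)) true true)
      (ffV (vertexOfK (NlegRoad m a) (m + 1) S)) (ffW (vertex2OfK (NlegRoad m a) (m + 1) S₂)) (Sum.inl u)) hκ (hinl u)).2
  · exact (secondMoment_abs_le_of_decay510 (P := crossWord ((2 : ℝ)⁻¹ • Ga (m + 1) a)
      ((-(2 : ℝ)⁻¹) • blk (sandP (m + 1) (Ga (m + 1) a) (multM (m + 1) (2 * a / ((m + 1 : ℕ) : ℝ) ^ 8) 2)) true true)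
      (ffV (vertexOfK (NlegRoad m a) (m + 1) S)) (ffW (vertex2OfK (NlegRoad m a) (m + 1) S₂)) (Sum.inr (x, y))) hσn (hinr x y)).2

end Summit.QuantumFields.BalabanUV.Beta.D1BFx.RestKernelSandwichPacked

end
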